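import Summits.MatrixMultiplication.MatrixMultiplication.Theorems.AbelianSTPPCensusShapeCertVQKDefs

/-!
# Abelian STPP census — kernel evaluation of the vQK certificate `checkQK` at order 475, path segments (part i)

Cell mm-stpp, rung F-M1; successor kernel item «vQK T_E ladder beyond 471» (vQK := vP ∧ E3⁺ ∧ E3K) in support of the closed crux item
stmt-MatrixMultiplication-19191; seat mm-stpp-vp-p2 (gen 3); support file (no definitions).  PATH SEGMENTS of `ShapeCertVQ.checkQK 475`
(`…ShapeCertVQKDefs`): `pathOutK 475 path i n` = at the node reached by `path` (pairs (block, member), last step first; `[]` = root)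
the node-level decision, else the walk of the pool's blocks `i … i+n−1`; `pathInK 475 path i j n` = the walk of the members
`j … j+n−1` of block `i`; each by `decide +kernel` (no `native_decide`, standard axioms, `Elab.async false`), sized by the seat's
planner (`work/PlanK.lean`: ≤ 10⁵ cost units per declaration).  Assembled into `checkQK 475 = true` in
`…AbelianSTPPCensusShapeCertVQEvalK475` by the lemmas of `…ShapeCertVQKSearchP`.
WHAT THIS IS NOT: Boolean evaluations; no statement about STPP families or `ω` by themselves.
-/

set_option linter.dupNamespace false -- `MatrixMultiplication.MatrixMultiplication` (summit = problem, D-0017)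
set_option autoImplicit false
set_option Elab.async false -- sequential kernel evaluations

namespace Summit.MatrixMultiplication.MatrixMultiplication.Theorems.ShapeCertVQ

set_option maxHeartbeats 0 in
/-- path segment of `checkQK 475` (planner cost ≈ 69678; kernel evaluation) -/
theorem pki_475_r_5x7_b0_0_14 : pathInK 475 [(5, 7)] 0 0 14 = true := by
  decide +kernel

set_option maxHeartbeats 0 in
/-- path segment of `checkQK 475` (planner cost ≈ 91509; kernel evaluation) -/
theorem pki_475_r_5x7_b0_14_10 : pathInK 475 [(5, 7)] 0 14 10 = true := by
  decide +kernel

set_option maxHeartbeats 0 in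
/-- path segment of `checkQK 475` (planner cost ≈ 25238; kernel evaluation) -/
theorem pki_475_r_5x7_b0_24_9999 : pathInK 475 [(5, 7)] 0 24 9999 = true := by
  decide +kernel

set_option maxHeartbeats 0 in
/-- path segment of `checkQK 475` (planner cost ≈ 11781; kernel evaluation) -/
theorem pko_475_r_5x7_o1_9999 : pathOutK 475 [(5, 7)] 1 9999 = true := by
  decide +kernel

set_option maxHeartbeats 0 in
/-- path segment of `checkQK 475` (planner cost ≈ 96; kernel evaluation) -/
theorem pki_475_r_b5_8_12 : pathInK 475 [] 5 8 12 = true := by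
  decide +kernel

end Summit.MatrixMultiplication.MatrixMultiplication.Theorems.ShapeCertVQ
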